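import Mathlib.Analysis.Complex.CauchyIntegral
import Mathlib.Analysis.SpecialFunctions.Complex.Circle
import Mathlib.Tactic
import HarnessLib

/-!
# Taylor coefficients of a function holomorphic on a neighbourhood of the closed unit disc

The one-variable analytic input of the torus Cauchy estimate in Calegari–Dimitrov–Tang
(arXiv:2408.15403, §6.4–6.5: `G(𝐳) = h(z_1)⋯h(z_d)·F(Φ(𝐳))`, eq. (6.15), is a finite sum of
products of functions holomorphic on some neighbourhood of the closed unit disc, cf. "holomorphic on
some neighborhood of the closed unit polydisc"): if `g` is holomorphic on the closed disc
`|z| ≤ R` with `R > 1`, its Taylor coefficients `b_n = (2πi)⁻¹∮_{|z|=R} g(z) z^{−n−1} dz`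
(Mathlib's `cauchyPowerSeries`) decay geometrically, `|b_n| ≤ C R^{−n}`, hence `Σ_n |b_n| < ∞`,
and `g(z) = Σ_n b_n zⁿ` on `|z| < R`, in particular on the unit circle `g(e(θ)) = Σ_n b_n e(nθ)`.

* `taylorCoeff g R n`, `norm_taylorCoeff_le`, `summable_norm_taylorCoeff`;
* `hasSum_taylorCoeff` (`|z| < R`), `hasSum_taylorCoeff_circle` (`z = e(θ)`).

No named facts.

## References

* [CalegariDimitrovTang2024] arXiv:2408.15403, §6.4 eq. (6.15), §6.5.3 eq. (6.21).
-/

noncomputable section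

open Complex MeasureTheory Metric

open scoped Real NNReal

namespace Literature.Analysis.Fourier

namespace TorusCoeff

/-- The Taylor coefficients `b_n = (2πi)⁻¹ ∮_{|z|=R} g(z) z^{−n−1} dz` of `g` at `0`.
[folklore] -/
def taylorCoeff (g : ℂ → ℂ) (R : ℝ) (n : ℕ) : ℂ := cauchyPowerSeries g 0 R n fun _ => 1

/-- Evaluating the Cauchy power series: `p_n(z,…,z) = zⁿ · b_n`. [folklore] -/
theorem cauchyPowerSeries_apply_eq (g : ℂ → ℂ) (R : ℝ) (n : ℕ) (z : ℂ) :
    (cauchyPowerSeries g 0 R n fun _ => z) = z ^ n * taylorCoeff g R n := by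
  unfold taylorCoeff
  have h := (cauchyPowerSeries g 0 R n).map_smul_univ (fun _ : Fin n => z) (fun _ => (1 : ℂ))
  simp only [smul_eq_mul, mul_one, Finset.prod_const, Finset.card_univ, Fintype.card_fin] at h
  rw [h]

/-- **Cauchy's estimate**: `|b_n| ≤ C · R⁻¹ⁿ` with `C = (2π)⁻¹ ∫₀^{2π} |g(Re^{iθ})| dθ`. [folklore] -/
theorem norm_taylorCoeff_le (g : ℂ → ℂ) (R : ℝ) (n : ℕ) :
    ‖taylorCoeff g R n‖ ≤
      ((2 * π)⁻¹ * ∫ θ : ℝ in (0 : ℝ)..2 * π, ‖g (circleMap 0 R θ)‖) * |R|⁻¹ ^ n := by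
  unfold taylorCoeff
  refine ((cauchyPowerSeries g 0 R n).le_opNorm _).trans ?_
  simp only [norm_one, Finset.prod_const_one, mul_one]
  exact norm_cauchyPowerSeries_le g 0 R n

/-- **Absolute summability**: for `R > 1` the Taylor coefficients are absolutely summable.
[cite: CalegariDimitrovTang2024, §6.5.3 (absolute convergence on the torus behind eq. (6.21))] -/
theorem summable_norm_taylorCoeff (g : ℂ → ℂ) {R : ℝ} (hR : 1 < R) :
    Summable fun n => ‖taylorCoeff g R n‖ := by
  set C : ℝ := (2 * π)⁻¹ * ∫ θ : ℝ in (0 : ℝ)..2 * π, ‖g (circleMap 0 R θ)‖ with hC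
  have hC0 : 0 ≤ C := mul_nonneg (inv_nonneg.mpr (by positivity))
    (intervalIntegral.integral_nonneg (by positivity) fun _ _ => norm_nonneg _)
  have hr0 : 0 ≤ |R|⁻¹ := by positivity
  have hr1 : |R|⁻¹ < 1 := by
    rw [abs_of_pos (by linarith)]
    exact inv_lt_one_of_one_lt₀ hR
  refine Summable.of_nonneg_of_le (fun n => norm_nonneg _) (fun n => norm_taylorCoeff_le g R n) ?_
  exact (summable_geometric_of_lt_one hr0 hr1).mul_left C

/-- **Taylor expansion on the disc**: `g(z) = Σ_n b_n zⁿ` for `|z| < R` when `g` is holomorphic on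
`|z| ≤ R`. [folklore] -/
theorem hasSum_taylorCoeff {g : ℂ → ℂ} {R : ℝ≥0} (hR : 0 < R)
    (hg : DifferentiableOn ℂ g (closedBall 0 R)) {z : ℂ} (hz : ‖z‖ < R) :
    HasSum (fun n => taylorCoeff g R n * z ^ n) (g z) := by
  have hps := hg.hasFPowerSeriesOnBall hR
  have hmem : z ∈ Metric.eball (0 : ℂ) R := by
    rw [Metric.mem_eball, edist_zero_right, enorm_eq_nnnorm, ENNReal.coe_lt_coe]
    exact_mod_cast hz
  have h := hps.hasSum hmem
  rw [zero_add] at h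
  refine h.congr_fun fun n => ?_
  show taylorCoeff g R n * z ^ n = cauchyPowerSeries g 0 R n fun _ => z
  rw [cauchyPowerSeries_apply_eq, mul_comm]

/-- **On the unit circle** (`R > 1`): `g(e(θ)) = Σ_n b_n e(nθ)`. [cite: CalegariDimitrovTang2024,
§6.5.3 (the torus expansion behind eq. (6.21))] -/
theorem hasSum_taylorCoeff_circle {g : ℂ → ℂ} {R : ℝ≥0} (hR : 1 < R)
    (hg : DifferentiableOn ℂ g (closedBall 0 R)) (θ : ℝ) :
    HasSum (fun n => taylorCoeff g R n * Complex.exp (2 * π * I * (n : ℤ) * θ))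
      (g (Complex.exp (2 * π * I * θ))) := by
  have hz : ‖Complex.exp (2 * π * I * θ)‖ < (R : ℝ) := by
    rw [show (2 * π * I * θ : ℂ) = ((2 * π * θ : ℝ) : ℂ) * I by push_cast; ring,
      Complex.norm_exp_ofReal_mul_I]
    exact_mod_cast hR
  have hR0 : 0 < R := lt_trans zero_lt_one hR
  refine (hasSum_taylorCoeff hR0 hg hz).congr_fun fun n => ?_
  congr 1
  rw [← Complex.exp_nat_mul]
  congr 1
  push_cast; ring

/-- Tsum form on the unit circle. [folklore] -/
theorem tsum_taylorCoeff_circle {g : ℂ → ℂ} {R : ℝ≥0} (hR : 1 < R)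
    (hg : DifferentiableOn ℂ g (closedBall 0 R)) (θ : ℝ) :
    ∑' n, taylorCoeff g R n * Complex.exp (2 * π * I * (n : ℤ) * θ) = g (Complex.exp (2 * π * I * θ)) :=
  (hasSum_taylorCoeff_circle hR hg θ).tsum_eq

end TorusCoeff

end Literature.Analysis.Fourier
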